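import Summits.BirchSwinnertonDyer.BirchSwinnertonDyer.Theorems.KolyvaginRoadThreeSchneiderTamAtThreeHeightLogNumeratorSecondOrderCriterion
import Summits.BirchSwinnertonDyer.BirchSwinnertonDyer.Theorems.ClassRecordThreeRegCertKernel
import HarnessLib

/-!
# Crux `SchneiderTamAtThree` (item 19154) — THE HEIGHT IS THE LOGARITHM OF THE NUMERATOR, SECOND ORDER:
# a GENERIC one-congruence certificate checker in lane A's REG3CERT row format, and two rows

HONEST FRAMING (cell `bsd-stepL`, seat `bsd-stepL-tam3-p2` g2, WIDTH-LEVER second lane «closed-form Schneider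
local factor at 3 … finite case table proved once»; `--supports stmt-BirchSwinnertonDyer-19154 --as helper`):
THEOREMS ONLY, route-free (no Theses import); 0 definitions, 0 named facts, 0 sorry; every rung below is about
ONE curve; Schneider's conjecture is asserted nowhere; nothing class-wide is proved; BSD is not claimed.

* `rungTam_of_numCriterion₂` / `rung_of_numCriterion₂` — **generic checkers**: for an integer model
  `W = ⟨a₁, a₂, a₃, a₄, a₆⟩` (globally minimal), a point `Q = (a/e², b/e³)` on `W` with `e = 3ᵏe'`, `k ≥ 1`,
  `3 ∤ e'`, `gcd(a, e) = 1`, the gcd test of non-singular reduction everywhere (lane A's clause A3), and the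
  ONE integer congruence **`3^{2k+1} ∤ c₄·(a³ − a) + 2b₂b₄·e²`** (`b₂ = a₁² + 4a₂`, `b₄ = 2a₄ + a₁a₃`,
  `c₄ = b₂² − 24b₄`), the rung `ClassX11b W 3 → Ram W 3 → ¬split → (3 ∣ ∏c →) RegulatorNonvanishingAt W 3`
  holds modulo GZK (rank one). This REPLACES, for the 650 of lane A's 690 tabulated TRUE-OPEN rows whose
  height has `v₃(ĥ₃(Q)) ≤ 2k`, the residue certificates `(γ, ζ, ℓ, ω, κ, u)` of the REG3CERT/KERNEL
  checkers (`certNonsplit_of_residueCert{,O2,O3,…}`) by a single divisibility of integers — every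
  hypothesis is decided by `norm_num`/`decide`, no `3`-adic quantity is evaluated.
* `rungTam_100470a1`, `rungTam_101010b1` — two rows of record (kit j249075) re-certified this way:
  Cremona `100470a1` (a SECOND-ORDER row: `v₃(a² − 1) = 2 = 2k`, first-order silent, `v₃(N) = 2 < 3`) and
  `101010b1` (first order, `v₃(N) = 1`).

References: [SteinWuthrich2013] §4.2, Conj. 4.1; [SilvermanAEC2009] VII.2.1, VII.3.4; [KolyvaginEulerSystems1990]
Thm. A (GZK); tree: part 3 (`…SecondOrderCriterion`), lane A `ClassRecordThreeRegCertKernel` §§1–2 (model and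
point bookkeeping, admissibility from the gcd test).
-/

open scoped Classical

open WeierstrassCurve Literature.NumberTheory.EllipticCurves
  Literature.NumberTheory.EllipticCurves.Rank1Residual
  Literature.NumberTheory.EllipticCurves.SteinWuthrich2013
  Summit.BirchSwinnertonDyer.Rank1Residual
  Summit.BirchSwinnertonDyer.Rank1Residual.X11b

namespace Summit.BirchSwinnertonDyer.Rank1Residual.X11b.RegMult.HeightLogNumerator

/-! ### §9 The generic second-order certificate checker -/

section Checker

/-- `padicValNat 3 ((3ᵏ·e')²) = 2k` for `3 ∤ e'`. [folklore] -/
private theorem padicValNat_sq_eq {e' k : ℕ} (h3e' : ¬ 3 ∣ e') :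
    padicValNat 3 ((3 ^ k * e') ^ 2) = 2 * k := by
  haveI : Fact (Nat.Prime 3) := ⟨Nat.prime_three⟩
  have he' : e' ≠ 0 := by rintro rfl; exact h3e' (dvd_zero 3)
  have h3k : (3 : ℕ) ^ k ≠ 0 := pow_ne_zero _ (by norm_num)
  rw [padicValNat.pow (3 ^ k * e') 2, padicValNat.mul h3k he', padicValNat.prime_pow,
    padicValNat.eq_zero_of_not_dvd h3e']
  ring

/-- **Generic second-order REG3CERT checker, class-record shape** (crux `SchneiderAtThree`, item 19106; the
Kolyvagin-road twin below adds the unused binder `3 ∣ ∏c`): for the integer model `W = ⟨a₁,…,a₆⟩`, the point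
`Q = (a/e², b/e³)` with `e = 3ᵏe'`, `1 ≤ k`, `3 ∤ e'`, `gcd(a, e) = 1`, the gcd test `gcd(Φ_y e³, Φ_x e⁴) ∣ eⁿ`
(non-singular reduction at every prime) and **`3^{2k+1} ∤ N`, `N = c₄(a³ − a) + 2b₂b₄e²`**, the rung
`ClassX11b W 3 → Ram W 3 → ¬split(3) → RegulatorNonvanishingAt W 3` holds modulo GZK: the class gives
`Mult W 3` and (GZK) rank one, the point is admissible (`isAdmissible_of_one_lt_norm` + lane A's
`hasNonsingularReductionAt_of_gcd`), and `regulatorNonvanishingAt_three_of_num_criterion₂` applies with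
`num x = a`, `den x = e²`, `v₃(den x) = 2k`. ONE curve per application; nothing class-wide.
[cite: SteinWuthrich2013, §4.2 and Conj. 4.1] [cite: SilvermanAEC2009, VII.2.1] [cite: KolyvaginEulerSystems1990, Thm. A] -/
theorem rung_of_numCriterion₂ (hGZK : rank_eq_analyticRank_of_analyticRank_le_one) (W : WeierstrassCurve ℚ)
    {a₁ a₂ a₃ a₄ a₆ : ℤ} (hW : W = ⟨a₁, a₂, a₃, a₄, a₆⟩) [W.IsElliptic] [W.IsGloballyMinimal]
    {a b N : ℤ} {e' k n : ℕ}
    (H : ¬ 3 ∣ e' ∧ 1 ≤ k ∧ Nat.Coprime a.natAbs (3 ^ k * e') ∧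
      Int.gcd (2 * b + a₁ * a * (3 ^ k * e' : ℕ) + a₃ * (3 ^ k * e' : ℕ) ^ 3)
        (a₁ * b * (3 ^ k * e' : ℕ) - (3 * a ^ 2 + 2 * a₂ * a * (3 ^ k * e' : ℕ) ^ 2 + a₄ * (3 ^ k * e' : ℕ) ^ 4))
        ∣ (3 ^ k * e') ^ n ∧
      ((a₁ ^ 2 + 4 * a₂) ^ 2 - 24 * (2 * a₄ + a₁ * a₃)) * (a ^ 3 - a) +
        2 * (a₁ ^ 2 + 4 * a₂) * (2 * a₄ + a₁ * a₃) * ((3 ^ k * e' : ℕ) : ℤ) ^ 2 = N ∧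
      ¬ (3 : ℤ) ^ (2 * k + 1) ∣ N)
    {x y : ℚ} (hx : x = a / ((3 ^ k * e' : ℕ) : ℚ) ^ 2) (hy : y = b / ((3 ^ k * e' : ℕ) : ℚ) ^ 3)
    (hP : W.toAffine.Equation x y) :
    ClassX11b W 3 → Ram W 3 → ¬ W.HasSplitMultiplicativeReductionAtPrime 3 →
      ClassClosure.RegulatorNonvanishingAt W 3 := by
  intro hX _ hns
  obtain ⟨h3e', hk, hcop, hgcd, hN, hcrit⟩ := H
  haveI : Fact (Nat.Prime 3) := ⟨Nat.prime_three⟩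
  have he'0 : e' ≠ 0 := by rintro rfl; exact h3e' (dvd_zero 3)
  have he0 : (3 ^ k * e' : ℕ) ≠ 0 := by positivity
  have h3e : 3 ∣ 3 ^ k * e' := dvd_mul_of_dvd_left (dvd_pow_self 3 (by omega)) _
  have h : W.toAffine.Nonsingular x y :=
    (WeierstrassCurve.Affine.equation_iff_nonsingular (W := W.toAffine)).mp hP
  have hx1 : 1 < ‖(x : ℚ_[3])‖ :=
    (one_lt_norm_ratCast_iff 3 x).mpr (KernelCert.padicValRat_x_neg he0 hx hcop h3e)
  have hadm : W.IsAdmissible 3 (.some x y h) :=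
    isAdmissible_of_one_lt_norm (by norm_num) h hx1
      (KernelCert.hasNonsingularReductionAt_of_gcd W hW he0 hx hy hcop hgcd)
  -- `num x = a`, `den x = e²`
  set e : ℕ := 3 ^ k * e' with hedef
  have hcop2 : Nat.Coprime a.natAbs (((e : ℤ) ^ 2).natAbs) := by
    rw [Int.natAbs_pow, Int.natAbs_natCast]; exact hcop.pow_right 2
  have he2pos : (0 : ℤ) < (e : ℤ) ^ 2 := by positivity
  have hxq : x = ((a : ℤ) : ℚ) / (((e : ℤ) ^ 2 : ℤ) : ℚ) := by rw [hx]; push_cast; ring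
  have hnum : x.num = a := by rw [hxq]; exact Rat.num_div_eq_of_coprime he2pos hcop2
  have hden : (x.den : ℤ) = (e : ℤ) ^ 2 := by rw [hxq]; exact Rat.den_div_eq_of_coprime he2pos hcop2
  have hden' : x.den = e ^ 2 := by exact_mod_cast hden
  have hv : padicValNat 3 x.den = 2 * k := by rw [hden', hedef]; exact padicValNat_sq_eq h3e'
  -- the integer identity for `c₄(a³ − a) + 2b₂b₄ den x`
  have hN' : W.c₄ * ((x.num : ℚ) ^ 3 - x.num) + 2 * W.b₂ * W.b₄ * (x.den : ℚ) = (N : ℚ) := by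
    rw [hnum, show (x.den : ℚ) = ((x.den : ℤ) : ℚ) by norm_cast, hden, ← hN]
    subst hW
    simp only [WeierstrassCurve.c₄, WeierstrassCurve.b₂, WeierstrassCurve.b₄]
    push_cast
    ring
  have hcrit' : ¬ ((3 : ℤ) ^ (padicValNat 3 x.den + 1) ∣ N) := by rwa [hv]
  exact regulatorNonvanishingAt_three_of_num_criterion₂ hX.2.2.1 hns
    (mordellWeilRank_eq_one_of_analyticRank hGZK hX.1) hadm hN' hcrit'

/-- **Generic second-order REG3CERT checker, Kolyvagin-road shape** (crux `SchneiderTamAtThree`, item 19154):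
the same rung with the extra binder `3 ∣ ∏ c_ℓ`, which is not used. ONE curve per application.
[cite: SteinWuthrich2013, §4.2 and Conj. 4.1] [cite: KolyvaginEulerSystems1990, Thm. A] -/
theorem rungTam_of_numCriterion₂ (hGZK : rank_eq_analyticRank_of_analyticRank_le_one) (W : WeierstrassCurve ℚ)
    {a₁ a₂ a₃ a₄ a₆ : ℤ} (hW : W = ⟨a₁, a₂, a₃, a₄, a₆⟩) [W.IsElliptic] [W.IsGloballyMinimal]
    {a b N : ℤ} {e' k n : ℕ}
    (H : ¬ 3 ∣ e' ∧ 1 ≤ k ∧ Nat.Coprime a.natAbs (3 ^ k * e') ∧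
      Int.gcd (2 * b + a₁ * a * (3 ^ k * e' : ℕ) + a₃ * (3 ^ k * e' : ℕ) ^ 3)
        (a₁ * b * (3 ^ k * e' : ℕ) - (3 * a ^ 2 + 2 * a₂ * a * (3 ^ k * e' : ℕ) ^ 2 + a₄ * (3 ^ k * e' : ℕ) ^ 4))
        ∣ (3 ^ k * e') ^ n ∧
      ((a₁ ^ 2 + 4 * a₂) ^ 2 - 24 * (2 * a₄ + a₁ * a₃)) * (a ^ 3 - a) +
        2 * (a₁ ^ 2 + 4 * a₂) * (2 * a₄ + a₁ * a₃) * ((3 ^ k * e' : ℕ) : ℤ) ^ 2 = N ∧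
      ¬ (3 : ℤ) ^ (2 * k + 1) ∣ N)
    {x y : ℚ} (hx : x = a / ((3 ^ k * e' : ℕ) : ℚ) ^ 2) (hy : y = b / ((3 ^ k * e' : ℕ) : ℚ) ^ 3)
    (hP : W.toAffine.Equation x y) :
    ClassX11b W 3 → Ram W 3 → ¬ W.HasSplitMultiplicativeReductionAtPrime 3 → 3 ∣ W.tamagawaProduct →
      ClassClosure.RegulatorNonvanishingAt W 3 :=
  fun hX hram hns _ => rung_of_numCriterion₂ hGZK W hW H hx hy hP hX hram hns

end Checker

/-! ### §10 Two rows of record re-certified by ONE congruence each -/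

section Rows

/-- **Cremona `100470a1` at `3`, a SECOND-ORDER row of lane A's REG3CERT/v1 (kit j249075), by one congruence.**
`W = ⟨1, 1, 0, −134818, 18997108⟩`, `Q = 2•P = (47701/15², −363019/15³)` (`k = 1`, `e' = 5`);
`b₂ = 5`, `b₄ = −269636`, `c₄ = 6471289`; the first-order criterion is SILENT (`v₃(47701² − 1) = 2 = 2k`) and
`N = c₄(a³ − a) + 2b₂b₄e² = 702381794192437719600` has `v₃(N) = 2 < 3`, so `ĥ₃(Q) ≠ 0` (indeed
`v₃(ĥ₃(Q)) = 2`, lane A's row: residues `(γ, ζ, ℓ, ω, κ, u)` no longer needed). One curve; modulo GZK; closes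
nothing by itself. [cite: SteinWuthrich2013, §4.2] [cite: KolyvaginEulerSystems1990, Thm. A] -/
theorem rungTam_100470a1 (hGZK : rank_eq_analyticRank_of_analyticRank_le_one) (W : WeierstrassCurve ℚ)
    (hW : W = ⟨1, 1, 0, -134818, 18997108⟩) [W.IsElliptic] [W.IsGloballyMinimal] :
    ClassX11b W 3 → Ram W 3 → ¬ W.HasSplitMultiplicativeReductionAtPrime 3 → 3 ∣ W.tamagawaProduct →
      ClassClosure.RegulatorNonvanishingAt W 3 :=
  rungTam_of_numCriterion₂ hGZK W hW (a := 47701) (b := -363019) (N := 702381794192437719600)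
    (e' := 5) (k := 1) (n := 0) (by norm_num) (x := 47701 / 225) (y := -363019 / 3375)
    (by norm_num) (by norm_num) (by subst hW; rw [WeierstrassCurve.Affine.equation_iff]; norm_num)

/-- **Cremona `101010b1` at `3`, a FIRST-ORDER row of lane A's REG3CERT/v1 (kit j249075), by the same one
congruence.** `W = ⟨1, 1, 0, −1988, 33852⟩`, `Q = 4•P = (4631197/399², −3539730202/399³)` (`k = 1`, `e' = 133`);
`b₂ = 5`, `b₄ = −3976`, `c₄ = 95449`; `N = 9480934548294387557466264`, `v₃(N) = 1 < 3` (first order fires: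
`v₃(a² − 1) = 1`). One curve; modulo GZK; closes nothing by itself. [cite: SteinWuthrich2013, §4.2]
[cite: KolyvaginEulerSystems1990, Thm. A] -/
theorem rungTam_101010b1 (hGZK : rank_eq_analyticRank_of_analyticRank_le_one) (W : WeierstrassCurve ℚ)
    (hW : W = ⟨1, 1, 0, -1988, 33852⟩) [W.IsElliptic] [W.IsGloballyMinimal] :
    ClassX11b W 3 → Ram W 3 → ¬ W.HasSplitMultiplicativeReductionAtPrime 3 → 3 ∣ W.tamagawaProduct →
      ClassClosure.RegulatorNonvanishingAt W 3 :=
  rungTam_of_numCriterion₂ hGZK W hW (a := 4631197) (b := -3539730202) (N := 9480934548294387557466264)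
    (e' := 133) (k := 1) (n := 0) (by norm_num) (x := 4631197 / 159201) (y := -3539730202 / 63521199)
    (by norm_num) (by norm_num) (by subst hW; rw [WeierstrassCurve.Affine.equation_iff]; norm_num)

end Rows

end Summit.BirchSwinnertonDyer.Rank1Residual.X11b.RegMult.HeightLogNumerator
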